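import Literature.Geometry.Riemannian.PinchingEstimatesMinimisers
import Mathlib.LinearAlgebra.Matrix.DotProduct
import HarnessLib

/-!
# Critical orthonormal pairs of a symmetric `3 × 3` matrix along Hamilton's ODE
(topic `Geometry/Riemannian`)

Pointwise linear algebra for the ODE parts of Hamilton 1997, Thms. 1.3–1.7 (decomposition of
`Literature.Geometry.Riemannian.hamilton_chenZhu_pinching`, `PinchingEstimates.lean`). Hamilton's
differential inequalities (1986, Lemma 6.1; 1997, pp. 7–11) are evaluations of
`A' = A² + BᵗB + 2A^#` at eigenvectors; in the tree's variational language the extremal pairs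
for `a₁ + a₂ = min (uᵀAu + vᵀAv)` and `a₂ + a₃ = max (uᵀAu + vᵀAv)` are *critical orthonormal
pairs*: `uᵀAn = vᵀAn = 0` for the normal `n = u × v` (`PinchingEstimatesMinimisers.lean`,
`firstOrder_of_min`). PROVED here, for symmetric `A` and any `B`:

* `pairSum_field_eq` — the **exact identity** at a critical pair:
  `uᵀA'u + vᵀA'v = |Au|² + |Av|² + |ᵗBu|² + |ᵗBv|² + 2(nᵀAn)(uᵀAu + vᵀAv)`
  (Hamilton's `a₁² + a₂² + 2(a₁ + a₂)a₃ + b₁² + b₂²`, 1997, p. 7; resp.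
  `a₂² + a₃² + 2a₁(a₂ + a₃) + b₂² + b₃²`, p. 8), with `|Au|² + |Av|² = U² + V² + 2Y²`
  (`U = uᵀAu`, `V = vᵀAv`, `Y = uᵀAv`) and `nᵀAn = tr A - (U + V)`;
* `firstOrder_of_max` — the first-order conditions at a maximising pair;
* `normal_le_rayleigh_of_max` / `rayleigh_le_normal_of_min` — at a maximising (minimising)
  pair the normal carries the smallest (largest) Rayleigh quotient;
* `lowEig_mul_le_normSq` — at a minimising pair, `a₁(a₁ + a₂) ≤ a₁² + a₂²` in the form
  `λ (U + V) ≤ U² + V² + 2Y²` for `λ ≤ U, V`, `U + V ≥ 0` (Hamilton, p. 9: "`a₁² + a₂² ≥ a₁(a₁ + a₂)`");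
* `normSq_le_highEig_mul` — at a maximising pair on which `A` is positive,
  `a₂² + a₃² ≤ a₃(a₂ + a₃)` in the form `|Au|² + |Av|² ≤ λ(U + V)` for `λ` dominating the Rayleigh
  quotients (Hamilton, p. 9: "`a₂² + a₃² ≤ a₃(a₂ + a₃)`"), by the Cauchy–Schwarz inequality for the
  positive form `A` on the (invariant) plane.

## References

* R. S. Hamilton, Comm. Anal. Geom. 5 (1997), §2.1, proofs of Thms. 1.2–1.4 (pp. 7–9). [Hamilton1997]
* R. S. Hamilton, J. Differential Geom. 24 (1986), §6, Lemma 6.1 (p. 167). [Hamilton1986]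
-/

noncomputable section

open Set Real
open scoped Matrix BigOperators

namespace Literature.Geometry.Riemannian

namespace HamiltonODE

variable {A B : Matrix (Fin 3) (Fin 3) ℝ}

/-! ### The exact identity at a critical pair -/

/-- At a critical orthonormal pair (`uᵀAn = vᵀAn = 0`, `(u, v, n)` orthonormal, `A` symmetric):
`|Au|² + |Av|² = U² + V² + 2Y²`. [folklore] -/
theorem normSq_pair_eq (hA : A.IsSymm) {u v n : Fin 3 → ℝ} (hu : u ⬝ᵥ u = 1) (hv : v ⬝ᵥ v = 1)
    (hn : n ⬝ᵥ n = 1) (huv : u ⬝ᵥ v = 0) (hun : u ⬝ᵥ n = 0) (hvn : v ⬝ᵥ n = 0)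
    (hXu : u ⬝ᵥ (A *ᵥ n) = 0) (hXv : v ⬝ᵥ (A *ᵥ n) = 0) :
    (A *ᵥ u) ⬝ᵥ (A *ᵥ u) + (A *ᵥ v) ⬝ᵥ (A *ᵥ v) =
      (u ⬝ᵥ (A *ᵥ u)) ^ 2 + (v ⬝ᵥ (A *ᵥ v)) ^ 2 + 2 * (u ⬝ᵥ (A *ᵥ v)) ^ 2 := by
  rw [parseval_of_orthonormal hu hv hn huv hun hvn (A *ᵥ u),
    parseval_of_orthonormal hu hv hn huv hun hvn (A *ᵥ v), quad_comm_of_isSymm hA n u,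
    quad_comm_of_isSymm hA n v, hXu, hXv, quad_comm_of_isSymm hA v u]
  ring

/-- At a critical orthonormal pair, `|An|² = (nᵀAn)²`. [folklore] -/
theorem normSq_normal_eq {u v n : Fin 3 → ℝ} (hu : u ⬝ᵥ u = 1) (hv : v ⬝ᵥ v = 1)
    (hn : n ⬝ᵥ n = 1) (huv : u ⬝ᵥ v = 0) (hun : u ⬝ᵥ n = 0) (hvn : v ⬝ᵥ n = 0)
    (hXu : u ⬝ᵥ (A *ᵥ n) = 0) (hXv : v ⬝ᵥ (A *ᵥ n) = 0) :
    (A *ᵥ n) ⬝ᵥ (A *ᵥ n) = (n ⬝ᵥ (A *ᵥ n)) ^ 2 := by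
  rw [parseval_of_orthonormal hu hv hn huv hun hvn (A *ᵥ n), hXu, hXv]
  ring

/-- At a critical orthonormal pair, `tr A = U + V + nᵀAn`. [folklore] -/
theorem trace_eq_pair_add_normal {u v n : Fin 3 → ℝ} (hu : u ⬝ᵥ u = 1) (hv : v ⬝ᵥ v = 1)
    (hn : n ⬝ᵥ n = 1) (huv : u ⬝ᵥ v = 0) (hun : u ⬝ᵥ n = 0) (hvn : v ⬝ᵥ n = 0) :
    A.trace = u ⬝ᵥ (A *ᵥ u) + v ⬝ᵥ (A *ᵥ v) + n ⬝ᵥ (A *ᵥ n) :=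
  (sum_quadratic_eq_trace_of_orthonormal A hu hv hn huv hun hvn).symm

/-- **The exact form of Hamilton's `d/dt (a₁ + a₂)` (resp. `d/dt (a₂ + a₃)`) at a critical pair**
(Hamilton 1997, p. 7: `a₁² + a₂² + 2(a₁ + a₂)a₃ + b₁² + b₂²`; p. 8: `a₂² + a₃² + 2a₁(a₂ + a₃) + b₂² + b₃²`):
for symmetric `A`, any `B`, and an orthonormal basis `(u, v, n)` with `uᵀAn = vᵀAn = 0`,
`uᵀA'u + vᵀA'v = |Au|² + |Av|² + |ᵗBu|² + |ᵗBv|² + 2(nᵀAn)(uᵀAu + vᵀAv)`, `A' = A² + BᵗB + 2A^#`.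
[cite: Hamilton1997, §2.1, Thms. 1.2 and 1.4 (proofs, pp. 7–8)] -/
theorem pairSum_field_eq (hA : A.IsSymm) {u v n : Fin 3 → ℝ} (hu : u ⬝ᵥ u = 1) (hv : v ⬝ᵥ v = 1)
    (hn : n ⬝ᵥ n = 1) (huv : u ⬝ᵥ v = 0) (hun : u ⬝ᵥ n = 0) (hvn : v ⬝ᵥ n = 0)
    (hXu : u ⬝ᵥ (A *ᵥ n) = 0) (hXv : v ⬝ᵥ (A *ᵥ n) = 0) :
    u ⬝ᵥ ((A * A + B * Bᵀ + (2 : ℝ) • A.sharp) *ᵥ u) +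
      v ⬝ᵥ ((A * A + B * Bᵀ + (2 : ℝ) • A.sharp) *ᵥ v) =
      (A *ᵥ u) ⬝ᵥ (A *ᵥ u) + (A *ᵥ v) ⬝ᵥ (A *ᵥ v) + (Bᵀ *ᵥ u) ⬝ᵥ (Bᵀ *ᵥ u) +
        (Bᵀ *ᵥ v) ⬝ᵥ (Bᵀ *ᵥ v) + 2 * (n ⬝ᵥ (A *ᵥ n)) * (u ⬝ᵥ (A *ᵥ u) + v ⬝ᵥ (A *ᵥ v)) := by
  have htr := trace_eq_pair_add_normal (A := A) hu hv hn huv hun hvn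
  have htr2 : (A * A).trace =
      (A *ᵥ u) ⬝ᵥ (A *ᵥ u) + (A *ᵥ v) ⬝ᵥ (A *ᵥ v) + (n ⬝ᵥ (A *ᵥ n)) ^ 2 := by
    rw [← sum_quadratic_eq_trace_of_orthonormal (A * A) hu hv hn huv hun hvn,
      quad_mul_self_of_isSymm hA, quad_mul_self_of_isSymm hA, quad_mul_self_of_isSymm hA,
      normSq_normal_eq (A := A) hu hv hn huv hun hvn hXu hXv]
  have eu : u ⬝ᵥ ((A * A + B * Bᵀ + (2 : ℝ) • A.sharp) *ᵥ u) = (A *ᵥ u) ⬝ᵥ (A *ᵥ u) +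
      (Bᵀ *ᵥ u) ⬝ᵥ (Bᵀ *ᵥ u) + 2 * ((A *ᵥ u) ⬝ᵥ (A *ᵥ u) - A.trace * (u ⬝ᵥ (A *ᵥ u)) +
        (A.trace ^ 2 - (A * A).trace) / 2) := by
    rw [Matrix.add_mulVec, Matrix.add_mulVec, dotProduct_add, dotProduct_add, Matrix.smul_mulVec,
      dotProduct_smul, smul_eq_mul, quad_sharp, quad_adjugate A u hu, quad_mul_self_of_isSymm hA,
      quad_mul_transpose_self]
  have ev : v ⬝ᵥ ((A * A + B * Bᵀ + (2 : ℝ) • A.sharp) *ᵥ v) = (A *ᵥ v) ⬝ᵥ (A *ᵥ v) +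
      (Bᵀ *ᵥ v) ⬝ᵥ (Bᵀ *ᵥ v) + 2 * ((A *ᵥ v) ⬝ᵥ (A *ᵥ v) - A.trace * (v ⬝ᵥ (A *ᵥ v)) +
        (A.trace ^ 2 - (A * A).trace) / 2) := by
    rw [Matrix.add_mulVec, Matrix.add_mulVec, dotProduct_add, dotProduct_add, Matrix.smul_mulVec,
      dotProduct_smul, smul_eq_mul, quad_sharp, quad_adjugate A v hv, quad_mul_self_of_isSymm hA,
      quad_mul_transpose_self]
  rw [eu, ev, htr2, htr]
  ring

/-! ### First-order conditions at a maximising pair; the normal's Rayleigh quotient -/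

/-- **First- and second-order optimality at a maximum on the sphere**: if `u` maximises `zᵀAz`
among the great circle `(u + ty)/√(1+t²)` towards a unit `y ⊥ u` (`A` symmetric), then
`uᵀAy = 0` and `yᵀAy ≤ uᵀAu` (`firstOrder_of_min` for `-A`). [folklore] -/
theorem firstOrder_of_max (hA : A.IsSymm) {u y : Fin 3 → ℝ}
    (hmax : ∀ t : ℝ, ((1 + t ^ 2)⁻¹.sqrt • (u + t • y)) ⬝ᵥ (A *ᵥ ((1 + t ^ 2)⁻¹.sqrt • (u + t • y)))
      ≤ u ⬝ᵥ (A *ᵥ u)) :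
    u ⬝ᵥ (A *ᵥ y) = 0 ∧ y ⬝ᵥ (A *ᵥ y) ≤ u ⬝ᵥ (A *ᵥ u) := by
  have h := firstOrder_of_min hA.neg (u := u) (y := y) (fun t ↦ by
    have := hmax t
    simp only [Matrix.neg_mulVec, dotProduct_neg]
    linarith)
  simp only [Matrix.neg_mulVec, dotProduct_neg, neg_eq_zero] at h
  exact ⟨h.1, by linarith [h.2]⟩

/-- For a unit `z` there is an orthonormal pair orthogonal to `z` whose `A`-sum is `tr A - zᵀAz`.
[folklore] -/
theorem exists_pair_perp_sum_eq (z : Fin 3 → ℝ) (hz : z ⬝ᵥ z = 1) :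
    ∃ y y' : Fin 3 → ℝ, y ⬝ᵥ y = 1 ∧ y' ⬝ᵥ y' = 1 ∧ y ⬝ᵥ y' = 0 ∧ z ⬝ᵥ y = 0 ∧ z ⬝ᵥ y' = 0 ∧
      y ⬝ᵥ (A *ᵥ y) + y' ⬝ᵥ (A *ᵥ y') = A.trace - z ⬝ᵥ (A *ᵥ z) := by
  obtain ⟨y, y', hy, hy', hzy, hzy', hyy'⟩ := exists_orthonormal_complement hz
  refine ⟨y, y', hy, hy', hyy', hzy, hzy', ?_⟩
  have := sum_quadratic_eq_trace_of_orthonormal A hz hy hy' hzy hzy' hyy'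
  linarith

/-- **At a maximising pair the normal has the smallest Rayleigh quotient**: if the orthonormal
pair `(u, v)` with normal `n` maximises `uᵀAu + vᵀAv` over orthonormal pairs, then
`nᵀAn ≤ zᵀAz` for every unit `z` (`nᵀAn = tr A - max = a₁`). [folklore] -/
theorem normal_le_rayleigh_of_max {u v n : Fin 3 → ℝ} (hu : u ⬝ᵥ u = 1) (hv : v ⬝ᵥ v = 1)
    (hn : n ⬝ᵥ n = 1) (huv : u ⬝ᵥ v = 0) (hun : u ⬝ᵥ n = 0) (hvn : v ⬝ᵥ n = 0)
    (hmax : ∀ y y' : Fin 3 → ℝ, y ⬝ᵥ y = 1 → y' ⬝ᵥ y' = 1 → y ⬝ᵥ y' = 0 →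
      y ⬝ᵥ (A *ᵥ y) + y' ⬝ᵥ (A *ᵥ y') ≤ u ⬝ᵥ (A *ᵥ u) + v ⬝ᵥ (A *ᵥ v))
    {z : Fin 3 → ℝ} (hz : z ⬝ᵥ z = 1) : n ⬝ᵥ (A *ᵥ n) ≤ z ⬝ᵥ (A *ᵥ z) := by
  obtain ⟨y, y', hy, hy', hyy', -, -, hsum⟩ := exists_pair_perp_sum_eq (A := A) z hz
  have h1 := hmax y y' hy hy' hyy'
  have h2 := trace_eq_pair_add_normal (A := A) hu hv hn huv hun hvn
  linarith

/-- **At a minimising pair the normal has the largest Rayleigh quotient** (`nᵀAn = a₃`). [folklore] -/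
theorem rayleigh_le_normal_of_min {u v n : Fin 3 → ℝ} (hu : u ⬝ᵥ u = 1) (hv : v ⬝ᵥ v = 1)
    (hn : n ⬝ᵥ n = 1) (huv : u ⬝ᵥ v = 0) (hun : u ⬝ᵥ n = 0) (hvn : v ⬝ᵥ n = 0)
    (hmin : ∀ y y' : Fin 3 → ℝ, y ⬝ᵥ y = 1 → y' ⬝ᵥ y' = 1 → y ⬝ᵥ y' = 0 →
      u ⬝ᵥ (A *ᵥ u) + v ⬝ᵥ (A *ᵥ v) ≤ y ⬝ᵥ (A *ᵥ y) + y' ⬝ᵥ (A *ᵥ y'))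
    {z : Fin 3 → ℝ} (hz : z ⬝ᵥ z = 1) : z ⬝ᵥ (A *ᵥ z) ≤ n ⬝ᵥ (A *ᵥ n) := by
  obtain ⟨y, y', hy, hy', hyy', -, -, hsum⟩ := exists_pair_perp_sum_eq (A := A) z hz
  have h1 := hmin y y' hy hy' hyy'
  have h2 := trace_eq_pair_add_normal (A := A) hu hv hn huv hun hvn
  linarith

/-! ### Hamilton's two eigenvalue inequalities in variational form -/

/-- `λ (U + V) ≤ U² + V² + 2Y²` whenever `λ ≤ U`, `λ ≤ V` and `U + V ≥ 0` (Hamilton 1997, p. 9: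
"`a₁² + a₂² ≥ a₁(a₁ + a₂)`"). [cite: Hamilton1997, §2.1, Thm. 1.4 (proof, p. 9)] -/
theorem lowEig_mul_le_normSq {lam U V Y : ℝ} (hU : lam ≤ U) (hV : lam ≤ V) (hUV : 0 ≤ U + V) :
    lam * (U + V) ≤ U ^ 2 + V ^ 2 + 2 * Y ^ 2 := by
  rcases le_total U V with h | h
  · nlinarith [sq_nonneg Y, mul_nonneg (sub_nonneg.2 h) (by linarith : (0 : ℝ) ≤ V),
      mul_nonneg (sub_nonneg.2 hU) hUV]
  · nlinarith [sq_nonneg Y, mul_nonneg (sub_nonneg.2 h) (by linarith : (0 : ℝ) ≤ U),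
      mul_nonneg (sub_nonneg.2 hV) hUV]

/-- **Cauchy–Schwarz along a line for a quadratic form**: if `(a - tb)ᵀA(a - tb) ≥ 0` for all
real `t` (`A` symmetric), then `(aᵀAb)² ≤ (aᵀAa)(bᵀAb)`. [folklore] -/
theorem quad_cauchySchwarz (hA : A.IsSymm) {a b : Fin 3 → ℝ}
    (hpos : ∀ t : ℝ, 0 ≤ (a - t • b) ⬝ᵥ (A *ᵥ (a - t • b))) :
    (a ⬝ᵥ (A *ᵥ b)) ^ 2 ≤ (a ⬝ᵥ (A *ᵥ a)) * (b ⬝ᵥ (A *ᵥ b)) := by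
  have hexp : ∀ t : ℝ, (a - t • b) ⬝ᵥ (A *ᵥ (a - t • b)) =
      a ⬝ᵥ (A *ᵥ a) - 2 * t * (a ⬝ᵥ (A *ᵥ b)) + t ^ 2 * (b ⬝ᵥ (A *ᵥ b)) := by
    intro t
    have hs := quad_comm_of_isSymm hA b a
    simp only [Matrix.mulVec_sub, Matrix.mulVec_smul, dotProduct_sub, sub_dotProduct, dotProduct_smul,
      smul_dotProduct, smul_eq_mul, hs]
    ring
  have hq : ∀ t : ℝ, 0 ≤ a ⬝ᵥ (A *ᵥ a) - 2 * t * (a ⬝ᵥ (A *ᵥ b)) + t ^ 2 * (b ⬝ᵥ (A *ᵥ b)) :=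
    fun t ↦ by rw [← hexp]; exact hpos t
  have hQa : 0 ≤ a ⬝ᵥ (A *ᵥ a) := by simpa using hq 0
  -- `bᵀAb ≥ 0`: otherwise `q(t) + q(-t) = 2aᵀAa + 2t² bᵀAb` becomes negative
  have hQb : 0 ≤ b ⬝ᵥ (A *ᵥ b) := by
    by_contra h
    rw [not_le] at h
    set t : ℝ := Real.sqrt ((a ⬝ᵥ (A *ᵥ a) + 1) / (-(b ⬝ᵥ (A *ᵥ b)))) with ht
    have ht2 : t ^ 2 = (a ⬝ᵥ (A *ᵥ a) + 1) / (-(b ⬝ᵥ (A *ᵥ b))) :=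
      Real.sq_sqrt (div_nonneg (by linarith) (by linarith))
    have h1 := hq t
    have h2 := hq (-t)
    have e : t ^ 2 * (b ⬝ᵥ (A *ᵥ b)) = -(a ⬝ᵥ (A *ᵥ a) + 1) := by
      rw [ht2, div_mul_eq_mul_div, mul_comm, ← div_mul_eq_mul_div, div_neg, div_self h.ne]
      ring
    nlinarith
  rcases hQb.eq_or_lt with hb | hb
  · -- `bᵀAb = 0` forces `aᵀAb = 0`
    have hab : a ⬝ᵥ (A *ᵥ b) = 0 := by
      by_contra h
      have h1 := hq ((a ⬝ᵥ (A *ᵥ a) + 1) / (2 * (a ⬝ᵥ (A *ᵥ b))))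
      rw [← hb] at h1
      have e : 2 * ((a ⬝ᵥ (A *ᵥ a) + 1) / (2 * (a ⬝ᵥ (A *ᵥ b)))) * (a ⬝ᵥ (A *ᵥ b)) =
          a ⬝ᵥ (A *ᵥ a) + 1 := by field_simp
      nlinarith
    rw [hab, ← hb]; simp
  · have h1 := hq ((a ⬝ᵥ (A *ᵥ b)) / (b ⬝ᵥ (A *ᵥ b)))
    have e1 : ((a ⬝ᵥ (A *ᵥ b)) / (b ⬝ᵥ (A *ᵥ b))) ^ 2 * (b ⬝ᵥ (A *ᵥ b)) =
        (a ⬝ᵥ (A *ᵥ b)) ^ 2 / (b ⬝ᵥ (A *ᵥ b)) := by field_simp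
    have e2 : 2 * ((a ⬝ᵥ (A *ᵥ b)) / (b ⬝ᵥ (A *ᵥ b))) * (a ⬝ᵥ (A *ᵥ b)) =
        2 * ((a ⬝ᵥ (A *ᵥ b)) ^ 2 / (b ⬝ᵥ (A *ᵥ b))) := by field_simp
    rw [e1, e2] at h1
    have h2 : (a ⬝ᵥ (A *ᵥ b)) ^ 2 / (b ⬝ᵥ (A *ᵥ b)) ≤ a ⬝ᵥ (A *ᵥ a) := by linarith
    rwa [div_le_iff₀ hb] at h2

/-- **`a₂² + a₃² ≤ a₃(a₂ + a₃)` in variational form** (Hamilton 1997, p. 9): at a critical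
orthonormal pair `(u, v)` with normal `n` (`uᵀAn = vᵀAn = 0`, so `Au, Av ⊥ n`), if `A` is
non-negative on the plane, `zᵀAz ≥ 0` for all `z ⊥ n`, and `λ` dominates the Rayleigh quotients
of unit vectors in the plane, then `|Au|² + |Av|² ≤ λ (uᵀAu + vᵀAv)` (Cauchy–Schwarz for the form
`A` on the plane: `|Az|² = zᵀA(Az) ≤ √(zᵀAz) √((Az)ᵀA(Az))` and `(Az)ᵀA(Az) ≤ λ|Az|²`).
[cite: Hamilton1997, §2.1, Thm. 1.4 (proof, p. 9)] -/
theorem normSq_le_highEig_mul (hA : A.IsSymm) {u v n : Fin 3 → ℝ} {lam : ℝ}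
    (hXu : u ⬝ᵥ (A *ᵥ n) = 0) (hXv : v ⬝ᵥ (A *ᵥ n) = 0)
    (hun : u ⬝ᵥ n = 0) (hvn : v ⬝ᵥ n = 0)
    (hpos : ∀ z : Fin 3 → ℝ, z ⬝ᵥ n = 0 → 0 ≤ z ⬝ᵥ (A *ᵥ z))
    (hlam : ∀ z : Fin 3 → ℝ, z ⬝ᵥ n = 0 → z ⬝ᵥ (A *ᵥ z) ≤ lam * (z ⬝ᵥ z)) :
    (A *ᵥ u) ⬝ᵥ (A *ᵥ u) + (A *ᵥ v) ⬝ᵥ (A *ᵥ v) ≤ lam * (u ⬝ᵥ (A *ᵥ u) + v ⬝ᵥ (A *ᵥ v)) := by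
  -- for `z ⊥ n` with `Az ⊥ n`: `|Az|² ≤ λ zᵀAz`
  have key : ∀ z : Fin 3 → ℝ, z ⬝ᵥ n = 0 → (A *ᵥ z) ⬝ᵥ n = 0 →
      (A *ᵥ z) ⬝ᵥ (A *ᵥ z) ≤ lam * (z ⬝ᵥ (A *ᵥ z)) := by
    intro z hzn hAzn
    -- Cauchy–Schwarz with `a = Az`, `b = z`: `((Az)ᵀAz)² ≤ ((Az)ᵀA(Az)) (zᵀAz)`
    have hcs := quad_cauchySchwarz hA (a := A *ᵥ z) (b := z) fun t ↦ hpos _ (by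
      simp [sub_dotProduct, smul_dotProduct, hzn, hAzn])
    have hsymm : (A *ᵥ z) ⬝ᵥ (A *ᵥ z) = z ⬝ᵥ (A *ᵥ (A *ᵥ z)) := by
      rw [quad_comm_of_isSymm hA z (A *ᵥ z)]
    -- `(Az)ᵀA(Az) ≤ λ |Az|²`
    have h2 := hlam (A *ᵥ z) hAzn
    have h3 := hpos z hzn
    have h4 : 0 ≤ (A *ᵥ z) ⬝ᵥ (A *ᵥ z) := Finset.sum_nonneg fun i _ ↦ mul_self_nonneg _
    -- combine: N² = ((Az)·(Az))² = (zᵀA(Az))² ≤ ((Az)ᵀA(Az)) (zᵀAz) ≤ λ N (zᵀAz)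
    rw [quad_comm_of_isSymm hA (A *ᵥ z) z] at hcs
    rw [← hsymm] at hcs
    by_cases hN : (A *ᵥ z) ⬝ᵥ (A *ᵥ z) = 0
    · rw [hN]
      rcases h3.eq_or_lt with h0 | hpos'
      · rw [← h0, mul_zero]
      · have hz0 : z ≠ 0 := by rintro rfl; simp at hpos'
        have hz2 : 0 < z ⬝ᵥ z := lt_of_le_of_ne (Finset.sum_nonneg fun i _ ↦ mul_self_nonneg _)
          (fun h ↦ hz0 (dotProduct_self_eq_zero.1 h.symm))
        have hl : 0 < lam := by
          have := hlam z hzn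
          nlinarith
        exact (mul_pos hl hpos').le
    · have hNpos : 0 < (A *ᵥ z) ⬝ᵥ (A *ᵥ z) := lt_of_le_of_ne h4 (Ne.symm hN)
      nlinarith [mul_le_mul_of_nonneg_right h2 h3]
  have hu' := key u hun (by rw [dotProduct_comm]; simpa [quad_comm_of_isSymm hA n u] using hXu)
  have hv' := key v hvn (by rw [dotProduct_comm]; simpa [quad_comm_of_isSymm hA n v] using hXv)
  linarith

end HamiltonODE

end Literature.Geometry.Riemannian

end
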